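import Literature.NumberTheory.Automorphic.IsAutomorphicAE
import Literature.NumberTheory.Automorphic.AdicCompletionLocalField
import Literature.NumberTheory.GaloisRepresentations.LabelledHodgeTateWeights
import Literature.NumberTheory.GaloisRepresentations.FramedRepTwist
import Literature.NumberTheory.GaloisRepresentations.ResidualGaloisRep
import Literature.NumberTheory.EllipticCurves.NewformGaloisRep
import Literature.NumberTheory.PAdicHodge.FontaineDpst
import HarnessLib

/-!
# The Fontaine–Mazur conjecture for `GL₂` at an odd prime, with no local restriction at `p`
# (Kisin 2009; Tung 2021, Thm. 1 and Thm. 4.5)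

Topic `Literature/NumberTheory/Automorphic` (companion of `FontaineMazurHilbertTotallySplit`,
whose `HuTan2015_theorem63` is the crystalline, `p ≥ 5` case of the second fact below, and of
`IsAutomorphicAE`).  Two NAMED FACTS (D-0014): `Tung2021_fontaineMazurGL2` (over `ℚ`) and
`Tung2021_hilbertTotallySplit` (over a totally real field in which `p` splits completely), and
one proved corollary.

## The printed theorems (S.-N. Tung, *On the automorphy of 2-dimensional potentially semistable
## deformation rings of `G_{ℚ_p}`*, Algebra Number Theory 15 (2021) 2173–2194 [Tung2021];
## read in the held text arXiv:1803.07451, whose numbering is used)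

* **Theorem 1** (Introduction): "Let `p > 2`, `S` a finite set of primes containing `{p, ∞}`,
  `G_{ℚ,S}` the Galois group of the maximal extension of `ℚ` unramified outside `S`, and
  `G_{ℚ_p} ⊂ G_{ℚ,S}` a decomposition group at `p`.  Let `ρ : G_{ℚ,S} → GL₂(𝒪)` be a continuous
  irreducible odd representation.  Suppose that • `ρ̄|_{ℚ(ζ_p)}` is absolutely irreducible.
  • `ρ|_{G_{ℚ_p}}` is potentially semi-stable with distinct Hodge–Tate weights.  Then (up to
  twist) `ρ` comes from a cuspidal eigenform."  (`𝒪` = the integers of a finite `E/ℚ_p`.)  This is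
  Kisin's theorem (J. Amer. Math. Soc. 22 (2009), Theorem of the Introduction, p. 642) with
  Kisin's hypotheses (2) ("`ρ` becomes semi-stable over an abelian extension") and (4)
  ("`ρ̄|_{G_{ℚ_p}} ≁ (ωχ *; 0 χ)`") removed — (2) by the `p`-adic local Langlands correspondence
  (Colmez, Paškūnas, as recorded by Kisin loc. cit. and Hu–Tan), (4) for `p ≥ 5` by Paškūnas 2015
  and Hu–Tan 2015 and for `p = 3` by Tung (Abstract: "a local restriction in the proof of
  Fontaine–Mazur conjecture in [Kisin] is removed"; Remark 4.6: "The result is new when `p = 3` and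
  `ρ̄|_{G_{F_v}}` is a twist of an extension of `1` by `ω`").
* **Theorem 4.5**: "Let `p` be an odd prime and let `F` be a totally real field in which `p`
  splits completely.  Let `ρ : G_{F,S} → GL₂(𝒪)` be a continuous representation.  Suppose that
  • `ρ̄` is modular (thus `ρ` and `ρ̄` are odd). • `ρ̄|_{F(ζ_p)}` is absolutely irreducible.
  • `ρ|_{G_{F_v}}` is potentially semi-stable with distinct Hodge–Tate weights for each `v ∣ p`.
  Then (up to twist) `ρ` comes from a Hilbert modular form."  ("Following from the method of
  [Kisin 2009] and [Hu–Tan 2015]", i.e. Kisin's Thm. (2.2.18) with its local hypothesis (3)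
  removed by the Breuil–Mézard conjecture for all `ρ̄ : G_{ℚ_p} → GL₂(k)`, `p > 2`, Tung's
  Thm. 1.2.)

## Rendering in the tree's vocabulary (read before reviewing)

* `ρ : G_{F,S} → GL₂(𝒪)` continuous: a continuous `ρ : Γ_F → GL₂(ℚ̄_p)` (`FramedGaloisRep`)
  unramified at all but finitely many places (such a `ρ` has a model over a finite `E/ℚ_p` and
  stabilises an `𝒪_E`-lattice — the accepted, proved `exists_hasQlModel_holds` — so this is the
  printed setting); "irreducible", "odd": `ρ.toGaloisRep.IsIrreducible`, `ρ.IsOdd` (`det ρ(c) = -1`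
  at every complex conjugation; for Thm. 4.5 Tung prints oddness as a consequence of the residual
  modularity — it is kept as an explicit hypothesis, which only weakens the fact).
* "`ρ̄|_{F(ζ_p)}` absolutely irreducible": `(ρ.restrictField (CyclotomicField p F))
  .IsResiduallyAbsIrreducible` — some (equivalently, by Brauer–Nesbitt, every) reduction of
  `ρ|_{Γ_{F(ζ_p)}}` over `ℤ̄_p/𝔪` is absolutely irreducible (accepted `ResidualGaloisRep`; the
  hypothesis of route `Langlands/EvenVoidBelowEight` is the same predicate over `ℚ`).  This is
  equivalent to the trace rendering used in `HuTan2015_theorem63` (no finite-order characters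
  `χ₁, χ₂` of `Γ_{F(ζ_p)}` with `|tr ρ - χ₁ - χ₂|_p < 1`), `p > 2`.
* "potentially semistable with distinct Hodge–Tate weights at `v ∣ p`": de Rham for Fontaine's
  PINNED datum (`(fontainePstAdicCompletion v p hv).IsDeRhamFramed (ρ.toLocal v)`; de Rham ⟺
  potentially semistable, Berger 2002, as recorded in `FontaineDpst`) with multiplicity-free
  `τ`-labelled Hodge–Tate weights for every continuous `τ : F_v → ℚ̄_p`
  (`labelledHodgeTateWeightsAt … τ).Nodup`) — VERBATIM the clause of the route statements of
  `Langlands/EvenVoidBelowEight` (there `F = ℚ`).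
* "`p` splits completely in `F`": `p ∤ d_F` and every `v ∣ p` has residue field of order `p` — the
  rendering of `HuTan2015_theorem63` and of route `Langlands/WachComponentCensus`.
* "`ρ̄` is modular" (Thm. 4.5): as in `HuTan2015_theorem63` — there are a cuspidal automorphic `π₀`
  of `GL₂(𝔸_F)`, `L`-algebraic with a regular infinity type (a cohomological cuspidal Hilbert
  eigenform, dictionary of `HilbertModularGaloisRep`), and `ρ₀` attached to `π₀` at almost all
  places through `ι : ℚ̄_p ≃+* ℂ` (`SatakeFrobCompatibleAE`, so `ρ₀^{ss} ≅ ρ_{π₀,ι}`) with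
  `|tr ρ(σ) - tr ρ₀(σ)|_p < 1` for all `σ`, i.e. (`p > 2`) `ρ̄^{ss} ≅ ρ̄_{π₀,ι}^{ss}`, which for
  irreducible `ρ̄` is `ρ̄ ≅ ρ̄_{π₀,ι}` (any cohomological weight and level: Kisin (2.2.18), proof,
  via Gee's weight shifting).
* "(up to twist) `ρ` comes from …": the twist is EXPLICIT — some twist `ρ ⊗ χ` (accepted
  `FramedRep.twist`) by a continuous character `χ : Γ_F → ℚ̄_p^×` comes from the form.  The sources
  need only a power of the cyclotomic character (to move the Hodge–Tate weights `{a, b}` to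
  `{0, k - 1}`); quantifying over all continuous `χ` is the weakest reading of the printed words and
  is what is vendored (faithfulness over convenience; a consumer recovers that `χ` is de Rham from
  `ρ` and `ρ ⊗ χ` being so).
* "comes from a cuspidal eigenform" (Thm. 1, over `ℚ`): the CLASSICAL rendering of the tree — a
  newform `f ∈ S_k(Γ₁(N))` (accepted `IsNewform1`), an embedding `ι_f : K_f → ℚ̄_p` of its
  coefficient field (accepted `coeffCharField`, `ℚ(a_n(f), ε_f)`), and `ρ ⊗ χ` attached to `f` away
  from `N p` (accepted `IsGaloisRepOfNewform1 f ι_f {q ∣ N p}`: unramified at `q ∤ N p` with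
  `charpoly (ρ ⊗ χ)(Frob_q) = ι_f(X² - a_q X + ε(q) q^{k-1})`, arithmetic Frobenius — Deligne's
  normalisation, as in the accepted `exists_padicGaloisRep_of_isNewform1` and in the tree's
  statement of Serre's conjecture `SerreModularityConjecture`).  The Galois representation of a
  cuspidal eigenform is that of its newform, so "eigenform" and "newform" give the same class of
  `ρ`.
* "comes from a Hilbert modular form" (Thm. 4.5): the AUTOMORPHIC rendering of
  `HuTan2015_theorem63` — some cuspidal `π` of `GL₂(𝔸_F)`, `L`-algebraic with a regular infinity
  type, is attached to `ρ ⊗ χ` at almost all places (`SatakeFrobCompatibleAE ι π.1 (ρ ⊗ χ)`,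
  Buzzard–Gee's `L`-normalisation), i.e. `IsAutomorphicAE ι hcpt (ρ ⊗ χ)` plus regularity of `π_∞`
  (`Tung2021_hilbertTotallySplit.isAutomorphicAE_twist`).
* `hcpt` (the named fact `isCompact_glFiniteIntegralLevel 2 F`) only types `π₀`, `π` (D-0014).

## What is NOT here (and why)

* Tung's MAIN LOCAL THEOREMS — Thm. 4.1 ("`M_∞(σ°)[1/p]` is supported on every non-ordinary
  component of `Spec R_∞(σ)`"), Prop. 4.2 and Cor. 4.4 ("Every irreducible component of
  `R^□(σ)[1/p]` is automorphic") and Thm. 1.2 (the Breuil–Mézard conjecture for `GL₂(ℚ_p)`,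
  `p > 2`) — are NOT vendored: the tree has no carrier for Kisin's potentially semistable
  deformation rings of a fixed Galois type `(λ, τ)`, for the CEGGPS patched module `M_∞`, for
  Emerton–Gee's notion of an automorphic component, or for the Hilbert–Samuel / Serre-weight
  multiplicities of Breuil–Mézard (the barrier entry `Literature.Barriers.Langlands.
  PatchingLocalComponentBarrierNarrow` records these statements in prose, with the same
  citation).  They are definition items of their own if a route wants them typed.
* `p = 2` (Tung, Math. Z. 298 (2021) [Tung2020]); residually reducible or residually dihedral-at-
  `ℚ(ζ_p)` `ρ̄` (Skinner–Wiles; Pan 2022); `p` not totally split in `F`.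
* No discharge: both facts are irreducibly XL (the `p`-adic local Langlands correspondence for
  `GL₂(ℚ_p)` and Taylor–Wiles–Kisin patching).

## References

* S.-N. Tung, Algebra Number Theory 15 (2021) 2173–2194, Thm. 1 (Introduction), Thm. 4.5,
  Cor. 4.4, Remark 4.6 (numbering of arXiv:1803.07451). [Tung2021]
* M. Kisin, J. Amer. Math. Soc. 22 (2009) 641–690, Theorem of the Introduction (p. 642) and
  Thm. (2.2.18) (p. 685). [Kisin2009]
* Y. Hu, F. Tan, Ann. Sci. ÉNS 48 (2015) 1383–1421, Thm. 1.4 and Thm. 6.3. [HuTan2015]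
* V. Paškūnas, Duke Math. J. 164 (2015) 297–359, Thm. 1.1. [Paskunas2015]
* K. Buzzard, T. Gee, LMS Lecture Note Ser. 414 (2014), Conj. 3.2.2. [BuzzardGeeLMS2014]
* P. Deligne, J.-P. Serre, Ann. Sci. ÉNS 7 (1974), Thm. 6.1 (normalisation of `ρ_{f,λ}`).
  [DeligneSerreASENS1974]

## Addendum (2026-08-17): the residual hypothesis removed (Pan 2022; X. Zhang 2024)

A THIRD named fact, `XZhang2024_fontaineMazurGL2_oddPrime` (cite item wi-38052, route
`Langlands/DyadicOddResidue`, item `OddPrimesRegularFM`): VERBATIM `Tung2021_fontaineMazurGL2`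
WITHOUT the hypothesis `(ρ.restrictField (CyclotomicField p ℚ)).IsResiduallyAbsIrreducible` —
the Fontaine–Mazur conjecture for `GL₂/ℚ` in the regular case at EVERY odd prime, no residual
hypothesis.  Printed (held texts, quoted):

* L. Pan, *The Fontaine–Mazur conjecture in the residually reducible case*, J. Amer. Math. Soc. 35
  (2022) 1031–1169 = arXiv:1901.07166 [Pan2022], Conj. 1.0.1 ("`ρ : Gal(ℚ̄/ℚ) → GL₂(ℚ̄_p)`
  continuous, irreducible … only ramified at finitely many places, … potentially semi-stable …,
  odd … Then `ρ` arises from a cuspidal eigenform") and **Theorem 1.0.4**: "Let `p` be an odd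
  prime and `ρ` be as in conjecture 1.0.1. Assume that • `ρ|_{Gal(ℚ̄_p/ℚ_p)}` has distinct
  Hodge–Tate weights, • If `p = 3`, the semi-simplification of `ρ̄|_{Gal(ℚ̄_p/ℚ_p)}` is not of
  the form `η ⊕ ηω` for some character `η`. Then `ρ` comes from a cuspidal eigenform."
  ("combining the work of Skinner–Wiles, Kisin, Hu–Tan, we can prove the Fontaine–Mazur
  conjecture completely in the regular case when `p ≥ 5`.")
* X. Zhang, *On the Fontaine–Mazur conjecture for `p = 3`*, arXiv:2412.06812 (2024)
  [XZhang2024FontaineMazurP3], **Theorem 1.0.2** (= his Thms. 1.1 + 1.2, "combining the work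
  [Skinner–Wiles 2001], [Hu–Tan 2015], [Kisin 2009], [Pan 2022] and [Khare–Wintenberger 2009]"):
  "Let `p` be an odd prime number and `ρ : Gal(ℚ̄/ℚ) → GL₂(ℚ̄_p)` be a continuous, irreducible
  representation such that • `ρ` is only ramified at finitely many places, • `ρ|_{G_{ℚ_p}}` is de
  Rham of distinct Hodge–Tate weights, • `ρ` is odd. Then `ρ` arises from a cuspidal eigenform up
  to twist."  (Abstract: "we can conclude the conjecture in the regular case when `p` is an odd
  prime.")  A PREPRINT (Dec. 2024); the `p ≥ 5` part is Pan's published Theorem 1.0.4.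

Rendering: exactly as for `Tung2021_fontaineMazurGL2` above (same clauses, same classical
newform conclusion with an explicit twist — Zhang prints "up to twist"); the older fact is the
special case with the residual hypothesis (`XZhang2024_fontaineMazurGL2_oddPrime.tung2021`,
proved by dropping a hypothesis).
-/

noncomputable section

open scoped MatrixGroups Matrix NumberField ModularForm
open NumberField IsDedekindDomain Field Filter CongruenceSubgroup

namespace Literature.NumberTheory.Automorphic

open Literature.NumberTheory.GaloisRepresentations
open Literature.NumberTheory.EllipticCurves.ModularForms

/-- **Tung 2021, Theorem 1 (with Kisin 2009; Paškūnas 2015; Hu–Tan 2015): Fontaine–Mazur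
modularity for `GL₂` over `ℚ` at an odd prime, with no local restriction at `p`** — a THEOREM
(see the module docstring for the printed statement and the rendering).  Let `p > 2` and let
`ρ : Γ_ℚ → GL₂(ℚ̄_p)` be continuous, unramified at all but finitely many places, irreducible and
odd, such that `ρ̄|_{Γ_{ℚ(ζ_p)}}` is absolutely irreducible and `ρ|_{Γ_{ℚ_p}}` is potentially
semistable (= de Rham, for Fontaine's pinned datum `fontainePstAdicCompletion`) with distinct
Hodge–Tate weights.  Then, up to twist, `ρ` comes from a cuspidal eigenform: for some continuous
character `χ : Γ_ℚ → ℚ̄_p^×`, some newform `f ∈ S_k(Γ₁(N))` and some embedding `ι_f : K_f → ℚ̄_p` of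
its coefficient field, `ρ ⊗ χ` is attached to `f` away from `N p` — unramified at every prime
`q ∤ N p` with `charpoly (ρ ⊗ χ)(Frob_q) = ι_f(X² - a_q(f) X + ε_f(q) q^{k-1})` (arithmetic
Frobenius).  Named fact (D-0014).
[cite: Tung2021, Thm. 1 (Introduction; numbering of arXiv:1803.07451) and Remark 4.6]
[cite: Kisin2009, Theorem of the Introduction (p. 642)] [cite: HuTan2015, Thm. 1.4] -/
def Tung2021_fontaineMazurGL2 : Prop :=
  ∀ (p : ℕ) [Fact p.Prime], p ≠ 2 →
    ∀ (ρ : FramedGaloisRep ℚ (PadicAlgCl p) 2),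
      (∀ᶠ v : HeightOneSpectrum (𝓞 ℚ) in cofinite, ρ.IsUnramifiedAt v) →
      ρ.toGaloisRep.IsIrreducible → ρ.IsOdd →
      (ρ.restrictField (CyclotomicField p ℚ)).IsResiduallyAbsIrreducible →
      (∀ (v : HeightOneSpectrum (𝓞 ℚ)) (hv : ((p : ℕ) : 𝓞 ℚ) ∈ v.asIdeal),
        (PAdicHodge.fontainePstAdicCompletion v p hv).IsDeRhamFramed (ρ.toLocal v) ∧
        ∀ τ : v.adicCompletion ℚ →+* PadicAlgCl p, Continuous τ →
          (ρ.labelledHodgeTateWeightsAt v (PAdicHodge.fontainePstAdicCompletion v p hv).algebra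
            (PAdicHodge.fontainePstAdicCompletion v p hv).𝔅 τ).Nodup) →
      ∃ (χ : absoluteGaloisGroup ℚ →ₜ* (PadicAlgCl p)ˣ) (N : ℕ) (_ : NeZero N) (k : ℤ)
        (f : CuspForm (Gamma1 N) k) (ιf : coeffCharField f →+* PadicAlgCl p),
        IsNewform1 f ∧ IsGaloisRepOfNewform1 f ιf {q | q ∣ N * p} (FramedRep.twist ρ χ)

/-- **Tung 2021, Theorem 4.5 (with Kisin 2009, Thm. (2.2.18); Paškūnas 2015; Hu–Tan 2015,
Thm. 6.3): modularity of two-dimensional potentially semistable representations of a totally real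
field at a totally split odd prime** (see the module docstring for the printed statement and the
rendering).  Let `F` be a totally real number field and `p` an odd prime which splits completely in
`F` (`p ∤ d_F` and every `v ∣ p` has residue field `𝔽_p`).  Let `ρ : Γ_F → GL₂(ℚ̄_p)` be
continuous, unramified at all but finitely many places and (totally) odd, such that `ρ̄` is
modular (`ρ̄^{ss} ≅ ρ̄₀^{ss}` for some `ρ₀` attached at almost all places, through `ι : ℚ̄_p ≃ ℂ`,
to a cuspidal automorphic representation `π₀` of `GL₂(𝔸_F)` that is `L`-algebraic with a regular
infinity type), `ρ̄|_{Γ_{F(ζ_p)}}` is absolutely irreducible, and for every `v ∣ p` the restriction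
`ρ|_{Γ_{F_v}}` is potentially semistable (= de Rham for Fontaine's pinned datum) with distinct
Hodge–Tate weights for every continuous label `τ : F_v → ℚ̄_p`.  Then, up to twist, `ρ` comes from
a Hilbert modular form: for some continuous character `χ : Γ_F → ℚ̄_p^×`, some cuspidal `π` of
`GL₂(𝔸_F)`, `L`-algebraic with a regular infinity type, is attached to `ρ ⊗ χ` at almost all
places (`SatakeFrobCompatibleAE ι π.1 (ρ ⊗ χ)`, Buzzard–Gee's `L`-normalisation).  Named fact
(D-0014), `∀ hcpt`.
[cite: Tung2021, Thm. 4.5 and Remark 4.6 (numbering of arXiv:1803.07451)]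
[cite: Kisin2009, Thm. (2.2.18)] [cite: HuTan2015, Thm. 6.3] [cite: Paskunas2015, Thm. 1.1] -/
def Tung2021_hilbertTotallySplit : Prop :=
  ∀ (F : Type) [Field F] [NumberField F], IsTotallyReal F → ∀ (p : ℕ) [Fact p.Prime], p ≠ 2 →
    ¬ ((p : ℤ) ∣ NumberField.discr F) →
    (∀ v : HeightOneSpectrum (𝓞 F), ((p : ℕ) : 𝓞 F) ∈ v.asIdeal → v.residueCard = p) →
    ∀ (hcpt : isCompact_glFiniteIntegralLevel 2 F) (ι : PadicAlgCl p ≃+* ℂ)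
      (ρ : FramedGaloisRep F (PadicAlgCl p) 2),
      (∀ᶠ v : HeightOneSpectrum (𝓞 F) in cofinite, ρ.IsUnramifiedAt v) →
      ρ.IsOdd →
      (∃ (π₀ : CuspidalAutomorphicRepData 2 F hcpt) (ρ₀ : FramedGaloisRep F (PadicAlgCl p) 2),
          π₀.1.IsLAlgebraic ∧ (∃ T : InfinityType F 2, π₀.1.HasInfinityType T ∧ T.IsRegular) ∧
          SatakeFrobCompatibleAE ι π₀.1 ρ₀ ∧ ∀ σ, ‖(ρ σ).val.trace - (ρ₀ σ).val.trace‖ < 1) →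
      (ρ.restrictField (CyclotomicField p F)).IsResiduallyAbsIrreducible →
      (∀ (v : HeightOneSpectrum (𝓞 F)) (hv : ((p : ℕ) : 𝓞 F) ∈ v.asIdeal),
        (PAdicHodge.fontainePstAdicCompletion v p hv).IsDeRhamFramed (ρ.toLocal v) ∧
        ∀ τ : v.adicCompletion F →+* PadicAlgCl p, Continuous τ →
          (ρ.labelledHodgeTateWeightsAt v (PAdicHodge.fontainePstAdicCompletion v p hv).algebra
            (PAdicHodge.fontainePstAdicCompletion v p hv).𝔅 τ).Nodup) →
      ∃ (χ : absoluteGaloisGroup F →ₜ* (PadicAlgCl p)ˣ) (π : CuspidalAutomorphicRepData 2 F hcpt),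
        π.1.IsLAlgebraic ∧ (∃ T : InfinityType F 2, π.1.HasInfinityType T ∧ T.IsRegular) ∧
          SatakeFrobCompatibleAE ι π.1 (FramedRep.twist ρ χ)

/-- The conclusion of `Tung2021_hilbertTotallySplit` is automorphy of a twist in the sense of the
tree (`IsAutomorphicAE ι hcpt (ρ ⊗ χ)`, the conclusion of lang.S03 `FontaineMazurLanglandsGLn`)
together with regularity of the infinity type of `π`. [folklore] -/
theorem Tung2021_hilbertTotallySplit.isAutomorphicAE_twist (h : Tung2021_hilbertTotallySplit)
    {F : Type} [Field F] [NumberField F] (hF : IsTotallyReal F) {p : ℕ} [Fact p.Prime]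
    (hp : p ≠ 2) (hdisc : ¬ ((p : ℤ) ∣ NumberField.discr F))
    (hsplit : ∀ v : HeightOneSpectrum (𝓞 F), ((p : ℕ) : 𝓞 F) ∈ v.asIdeal → v.residueCard = p)
    (hcpt : isCompact_glFiniteIntegralLevel 2 F) (ι : PadicAlgCl p ≃+* ℂ)
    (ρ : FramedGaloisRep F (PadicAlgCl p) 2)
    (hunr : ∀ᶠ v : HeightOneSpectrum (𝓞 F) in cofinite, ρ.IsUnramifiedAt v) (hodd : ρ.IsOdd)
    (hmod : ∃ (π₀ : CuspidalAutomorphicRepData 2 F hcpt) (ρ₀ : FramedGaloisRep F (PadicAlgCl p) 2),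
          π₀.1.IsLAlgebraic ∧ (∃ T : InfinityType F 2, π₀.1.HasInfinityType T ∧ T.IsRegular) ∧
          SatakeFrobCompatibleAE ι π₀.1 ρ₀ ∧ ∀ σ, ‖(ρ σ).val.trace - (ρ₀ σ).val.trace‖ < 1)
    (hbig : (ρ.restrictField (CyclotomicField p F)).IsResiduallyAbsIrreducible)
    (hpst : ∀ (v : HeightOneSpectrum (𝓞 F)) (hv : ((p : ℕ) : 𝓞 F) ∈ v.asIdeal),
        (PAdicHodge.fontainePstAdicCompletion v p hv).IsDeRhamFramed (ρ.toLocal v) ∧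
        ∀ τ : v.adicCompletion F →+* PadicAlgCl p, Continuous τ →
          (ρ.labelledHodgeTateWeightsAt v (PAdicHodge.fontainePstAdicCompletion v p hv).algebra
            (PAdicHodge.fontainePstAdicCompletion v p hv).𝔅 τ).Nodup) :
    ∃ χ : absoluteGaloisGroup F →ₜ* (PadicAlgCl p)ˣ,
      IsAutomorphicAE ι hcpt (FramedRep.twist ρ χ) ∧
        ∃ π : CuspidalAutomorphicRepData 2 F hcpt, π.1.IsLAlgebraic ∧
          (∃ T : InfinityType F 2, π.1.HasInfinityType T ∧ T.IsRegular) ∧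
          SatakeFrobCompatibleAE ι π.1 (FramedRep.twist ρ χ) := by
  obtain ⟨χ, π, hL, hreg, hsat⟩ :=
    h F hF p hp hdisc hsplit hcpt ι ρ hunr hodd hmod hbig hpst
  exact ⟨χ, ⟨π, hL, hsat⟩, π, hL, hreg, hsat⟩

/-! ### The residual hypothesis removed: Pan 2022, X. Zhang 2024 -/

/-- **X. Zhang 2024, Theorem 1.0.2 (with Pan 2022, Thm. 1.0.4; Kisin 2009; Skinner–Wiles;
Hu–Tan 2015; Khare–Wintenberger): Fontaine–Mazur modularity for `GL₂` over `ℚ` in the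
regular case at EVERY odd prime, with NO residual hypothesis** — a THEOREM (module docstring,
"Addendum", for the printed statements).  Let `p > 2` and let `ρ : Γ_ℚ → GL₂(ℚ̄_p)` be continuous,
unramified at all but finitely many places, irreducible and odd, such that `ρ|_{Γ_{ℚ_p}}` is de
Rham (= potentially semistable, for Fontaine's pinned datum `fontainePstAdicCompletion`) with
distinct Hodge–Tate weights.  Then, up to twist, `ρ` comes from a cuspidal eigenform: for some
continuous character `χ : Γ_ℚ → ℚ̄_p^×`, some newform `f ∈ S_k(Γ₁(N))` and some embedding
`ι_f : K_f → ℚ̄_p` of its coefficient field, `ρ ⊗ χ` is attached to `f` away from `N p` —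
unramified at every prime `q ∤ N p` with
`charpoly (ρ ⊗ χ)(Frob_q) = ι_f(X² - a_q(f) X + ε_f(q) q^{k-1})` (arithmetic Frobenius).
VERBATIM `Tung2021_fontaineMazurGL2` without the hypothesis
`(ρ.restrictField (CyclotomicField p ℚ)).IsResiduallyAbsIrreducible` (same rendering, same
explicit twist — Zhang prints "up to twist").  The case `p ≥ 5` is Pan's published Thm. 1.0.4;
`p = 3` without Pan's local proviso is Zhang's preprint (Dec. 2024).  Named fact (D-0014); users
take `(h : XZhang2024_fontaineMazurGL2_oddPrime)`.
[cite: XZhang2024FontaineMazurP3, Thm. 1.0.2 (p. 2 of arXiv:2412.06812; = Thms. 1.1, 1.2)]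
[cite: Pan2022, Thm. 1.0.4 (setting of §1)]
[cite: Kisin2009, Theorem of the Introduction (p. 642)] [cite: Tung2021, Thm. 1] -/
def XZhang2024_fontaineMazurGL2_oddPrime : Prop :=
  ∀ (p : ℕ) [Fact p.Prime], p ≠ 2 →
    ∀ (ρ : FramedGaloisRep ℚ (PadicAlgCl p) 2),
      (∀ᶠ v : HeightOneSpectrum (𝓞 ℚ) in cofinite, ρ.IsUnramifiedAt v) →
      ρ.toGaloisRep.IsIrreducible → ρ.IsOdd →
      (∀ (v : HeightOneSpectrum (𝓞 ℚ)) (hv : ((p : ℕ) : 𝓞 ℚ) ∈ v.asIdeal),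
        (PAdicHodge.fontainePstAdicCompletion v p hv).IsDeRhamFramed (ρ.toLocal v) ∧
        ∀ τ : v.adicCompletion ℚ →+* PadicAlgCl p, Continuous τ →
          (ρ.labelledHodgeTateWeightsAt v (PAdicHodge.fontainePstAdicCompletion v p hv).algebra
            (PAdicHodge.fontainePstAdicCompletion v p hv).𝔅 τ).Nodup) →
      ∃ (χ : absoluteGaloisGroup ℚ →ₜ* (PadicAlgCl p)ˣ) (N : ℕ) (_ : NeZero N) (k : ℤ)
        (f : CuspForm (Gamma1 N) k) (ιf : coeffCharField f →+* PadicAlgCl p),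
        IsNewform1 f ∧ IsGaloisRepOfNewform1 f ιf {q | q ∣ N * p} (FramedRep.twist ρ χ)

/-- Zhang's theorem contains Tung's Theorem 1 (the case with the residual hypothesis
`ρ̄|_{Γ_{ℚ(ζ_p)}}` absolutely irreducible): drop that hypothesis.
[cite: XZhang2024FontaineMazurP3, Thm. 1.0.2] [cite: Tung2021, Thm. 1] -/
theorem XZhang2024_fontaineMazurGL2_oddPrime.tung2021
    (h : XZhang2024_fontaineMazurGL2_oddPrime) : Tung2021_fontaineMazurGL2 :=
  fun p _ hp ρ hunr hirr hodd _ hpst => h p hp ρ hunr hirr hodd hpst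

end Literature.NumberTheory.Automorphic

end
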